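import Mathlib.Analysis.InnerProductSpace.Adjoint
import Mathlib.Analysis.CStarAlgebra.Basic
import Mathlib.Analysis.SpecialFunctions.Pow.Real
import HarnessLib

/-!
# The Cotlar–Knapp–Stein almost orthogonality lemma (finite families)

Topic `Literature/Analysis/OperatorTheory`. Theorems only (no named fact, no new notion; the
auxiliary `csChain`, `csHead`, `csTail`, `csMean` are the bookkeeping of the printed proof).

**Lemma (Cotlar 1955; Knapp–Stein 1971), two-weight form.** Let `H` be a complex Hilbert space,
`ι` a finite index set and `T_i ∈ B(H)`, `i ∈ ι`. Suppose `a, b : ι × ι → [0, ∞)` satisfy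
`‖T_i T_j^*‖ ≤ a(i,j)²`, `‖T_i^* T_j‖ ≤ b(i,j)²`, and `∑_j a(i,j) ≤ A`, `∑_j b(i,j) ≤ B` for every
`i`. Then `‖∑_i T_i‖ ≤ √(A B)` (`cotlarStein_norm_sum_le`). With `a = b = √γ(i-j)` this is
[GrafakosMFA2014, §4.5.1, Lemma 4.5.1 (i)]: "`‖∑_{j∈Λ} T_j‖ ≤ A = ∑ √γ(j)` for all finite `Λ`".

Proof as printed in [GrafakosMFA2014, proof of Lemma 4.5.1 (i)] (read from the held scan,
PDF pp. 297–298), which applies verbatim to two weights: with `S = ∑ T_i`,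
`‖S‖² = ‖S S^*‖` and `‖(S S^*)^m‖ = ‖S S^*‖^m` for `m` a power of `2` (`S S^*` is self-adjoint;
Mathlib `CStarRing.norm_self_mul_star`, `IsSelfAdjoint.norm_pow_two_pow`); expand
`(S S^*)^m = ∑ T_{i₁} T_{j₁}^* ⋯ T_{i_m} T_{j_m}^*` (`pow_mul_star_sum_eq`, chains indexed by
`Fin m → ι × ι`); bound each chain in two ways — grouping `(T_{i₁}T_{j₁}^*)(T_{i₂}T_{j₂}^*)⋯`
(`norm_csChain_le_csHead`) and `T_{i₁}(T_{j₁}^*T_{i₂})⋯(T_{j_{m-1}}^*T_{i_m})T_{j_m}^*`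
(`norm_star_mul_csChain_le`) — take the geometric mean (`norm_csChain_succ_le`), sum first over the
last index and so on (`sum_csMean_le`, `norm_pow_succ_le`):
`‖S‖^{2m} ≤ |ι| · M · A · (AB)^{m-1}`, and let `m = 2^k → ∞`.

Mathlib has no Cotlar–Stein lemma (`lean search Cotlar` empty, 2026-08-15). Written for the
almost-orthogonality step (Step 3) of [DyatlovJinNonnenmacher2021, §2.4, proof of Prop. 2.9].

## References

* [GrafakosMFA2014] L. Grafakos, *Modern Fourier Analysis*, 3rd ed., GTM 250 (2014), §4.5.1,
  Lemma 4.5.1 and its proof (held scan `book:grafakos2009-modern-fourier-analysis`, PDF pp. 297–298).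
* M. Cotlar, Rev. Mat. Cuyana 1 (1955) 41–55; A. W. Knapp, E. M. Stein, Ann. of Math. 93 (1971)
  489–578 (history as recorded in [GrafakosMFA2014, §4.5, notes]).
* [DyatlovJinNonnenmacher2021] S. Dyatlov, L. Jin, S. Nonnenmacher, J. Amer. Math. Soc. 35 (2022),
  §2.4, proof of Prop. 2.9, Step 3 (the use made of the lemma in this tree).
-/

noncomputable section

open Finset

namespace Literature.Analysis.OperatorTheory

/-! ## Bookkeeping: chains and their weights -/

section Weights

variable {ι : Type*}

/-- `∏_k a(i_k, j_k)²` along a chain `(i₁,j₁),…,(i_m,j_m)` — the bound from the grouping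
`(T_{i₁}T_{j₁}^*)(T_{i₂}T_{j₂}^*)⋯`. [cite: GrafakosMFA2014, §4.5.1, proof of Lemma 4.5.1] -/
def csHead (a : ι → ι → ℝ) : (m : ℕ) → (Fin m → ι × ι) → ℝ
  | 0, _ => 1
  | m + 1, g => a (g 0).1 (g 0).2 ^ 2 * csHead a m (Fin.tail g)

/-- `b(j, i₁)² b(j₁, i₂)² ⋯ b(j_{m-1}, i_m)²` for a chain preceded by the index `j` — the bound from
the grouping `(T_j^*T_{i₁})(T_{j₁}^*T_{i₂})⋯`. [cite: GrafakosMFA2014, §4.5.1, proof of Lemma 4.5.1] -/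
def csTail (b : ι → ι → ℝ) : (m : ℕ) → ι → (Fin m → ι × ι) → ℝ
  | 0, _, _ => 1
  | m + 1, j, g => b j (g 0).1 ^ 2 * csTail b m (g 0).2 (Fin.tail g)

/-- The geometric mean weight `b(j,i₁) a(i₁,j₁) b(j₁,i₂) a(i₂,j₂) ⋯`. [cite: GrafakosMFA2014, §4.5.1, proof of Lemma 4.5.1] -/
def csMean (a b : ι → ι → ℝ) : (m : ℕ) → ι → (Fin m → ι × ι) → ℝ
  | 0, _, _ => 1
  | m + 1, j, g => b j (g 0).1 * a (g 0).1 (g 0).2 * csMean a b m (g 0).2 (Fin.tail g)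

/-- `csMean² = csHead · csTail`. [folklore] -/
theorem csMean_sq (a b : ι → ι → ℝ) :
    ∀ (m : ℕ) (j : ι) (g : Fin m → ι × ι), csMean a b m j g ^ 2 = csHead a m g * csTail b m j g
  | 0, _, _ => by simp [csMean, csHead, csTail]
  | m + 1, j, g => by
    simp only [csMean, csHead, csTail]
    rw [mul_pow, mul_pow, csMean_sq a b m (g 0).2 (Fin.tail g)]
    ring

/-- `0 ≤ csMean` for nonnegative weights. [folklore] -/
theorem csMean_nonneg {a b : ι → ι → ℝ} (ha0 : ∀ i j, 0 ≤ a i j) (hb0 : ∀ i j, 0 ≤ b i j) :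
    ∀ (m : ℕ) (j : ι) (g : Fin m → ι × ι), 0 ≤ csMean a b m j g
  | 0, _, _ => by simp [csMean]
  | m + 1, j, g => by
    simp only [csMean]
    exact mul_nonneg (mul_nonneg (hb0 _ _) (ha0 _ _)) (csMean_nonneg ha0 hb0 m _ _)

/-- Splitting a sum over chains of length `m + 1` into the first link and the rest. [folklore] -/
theorem sum_fin_succ_eq [Fintype ι] {M' : Type*} [AddCommMonoid M'] (m : ℕ)
    (F : (Fin (m + 1) → ι × ι) → M') :
    ∑ f, F f = ∑ q : ι × ι, ∑ g : Fin m → ι × ι, F (Fin.cons q g) := by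
  rw [Fintype.sum_equiv (Fin.consEquiv fun _ => ι × ι).symm F (fun p => F (Fin.cons p.1 p.2))
    (fun f => by simp only [Fin.consEquiv_symm_apply, Fin.cons_self_tail])]
  exact Fintype.sum_prod_type _

/-- Summing the mean weights "first over the last index, then the one before, …":
`∑_{chains} csMean ≤ (A B)^m`. [cite: GrafakosMFA2014, §4.5.1, proof of Lemma 4.5.1] -/
theorem sum_csMean_le [Fintype ι] {a b : ι → ι → ℝ} (ha0 : ∀ i j, 0 ≤ a i j)
    (hb0 : ∀ i j, 0 ≤ b i j) {A B : ℝ} (hA : ∀ i, ∑ j, a i j ≤ A) (hB : ∀ i, ∑ j, b i j ≤ B)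
    (hA0 : 0 ≤ A) (hB0 : 0 ≤ B) :
    ∀ (m : ℕ) (j : ι), ∑ g : Fin m → ι × ι, csMean a b m j g ≤ (A * B) ^ m := by
  intro m
  induction m with
  | zero => intro j; simp [csMean]
  | succ m ih =>
    intro j
    rw [sum_fin_succ_eq]
    simp only [csMean, Fin.cons_zero, Fin.tail_cons]
    calc ∑ q : ι × ι, ∑ g : Fin m → ι × ι, b j q.1 * a q.1 q.2 * csMean a b m q.2 g
        = ∑ q : ι × ι, b j q.1 * a q.1 q.2 * ∑ g : Fin m → ι × ι, csMean a b m q.2 g := by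
          simp_rw [Finset.mul_sum]
      _ ≤ ∑ q : ι × ι, b j q.1 * a q.1 q.2 * (A * B) ^ m := by
          gcongr with q
          · exact mul_nonneg (hb0 _ _) (ha0 _ _)
          · exact ih q.2
      _ = (∑ q : ι × ι, b j q.1 * a q.1 q.2) * (A * B) ^ m := by rw [Finset.sum_mul]
      _ ≤ (B * A) * (A * B) ^ m := by
          have hq : ∑ q : ι × ι, b j q.1 * a q.1 q.2 ≤ B * A :=
            calc ∑ q : ι × ι, b j q.1 * a q.1 q.2 = ∑ i, b j i * ∑ j', a i j' := by
                  rw [Fintype.sum_prod_type]; simp only [Finset.mul_sum]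
              _ ≤ ∑ i, b j i * A := by
                  gcongr with i
                  · exact hb0 _ _
                  · exact hA i
              _ = (∑ i, b j i) * A := by rw [Finset.sum_mul]
              _ ≤ B * A := by gcongr; exact hB j
          gcongr
      _ = (A * B) ^ (m + 1) := by ring

end Weights

/-! ## The operator chains -/

section Chains

variable {E : Type*} [NormedAddCommGroup E] [InnerProductSpace ℂ E] [CompleteSpace E]
variable {ι : Type*}

/-- The chain `T_{i₁} T_{j₁}^* T_{i₂} T_{j₂}^* ⋯ T_{i_m} T_{j_m}^*` for
`f = ((i₁,j₁),…,(i_m,j_m))`. [cite: GrafakosMFA2014, §4.5.1, proof of Lemma 4.5.1, (4.5.6)] -/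
def csChain (T : ι → E →L[ℂ] E) : (m : ℕ) → (Fin m → ι × ι) → (E →L[ℂ] E)
  | 0, _ => 1
  | m + 1, f => T (f 0).1 * star (T (f 0).2) * csChain T m (Fin.tail f)

/-- **Expansion** `(S S^*)^m = ∑_{i₁,j₁,…,i_m,j_m} T_{i₁}T_{j₁}^* ⋯ T_{i_m}T_{j_m}^*`,
`S = ∑_i T_i`. [cite: GrafakosMFA2014, §4.5.1, proof of Lemma 4.5.1, (4.5.6)] -/
theorem pow_mul_star_sum_eq [Fintype ι] (T : ι → E →L[ℂ] E) (m : ℕ) :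
    ((∑ i, T i) * star (∑ i, T i)) ^ m = ∑ f : Fin m → ι × ι, csChain T m f := by
  induction m with
  | zero =>
    rw [pow_zero, Fintype.sum_unique]
    rfl
  | succ m ih =>
    rw [pow_succ', ih]
    have h1 : (∑ i, T i) * star (∑ i, T i) = ∑ q : ι × ι, T q.1 * star (T q.2) := by
      rw [star_sum, Finset.sum_mul_sum, Fintype.sum_prod_type]
    rw [h1, Finset.sum_mul_sum, sum_fin_succ_eq]
    refine Finset.sum_congr rfl fun q _ => Finset.sum_congr rfl fun g _ => ?_
    simp only [csChain, Fin.cons_zero, Fin.tail_cons]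

/-- First grouping: `‖T_{i₁}T_{j₁}^* ⋯ T_{i_m}T_{j_m}^*‖ ≤ ∏ a(i_k,j_k)²`. [cite: GrafakosMFA2014, §4.5.1, proof of Lemma 4.5.1] -/
theorem norm_csChain_le_csHead (T : ι → E →L[ℂ] E) {a : ι → ι → ℝ}
    (ha : ∀ i j, ‖T i * star (T j)‖ ≤ a i j ^ 2) :
    ∀ (m : ℕ) (g : Fin m → ι × ι), ‖csChain T m g‖ ≤ csHead a m g
  | 0, _ => by
    simp only [csChain, csHead]
    rw [ContinuousLinearMap.one_def]
    exact ContinuousLinearMap.norm_id_le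
  | m + 1, g => by
    simp only [csChain, csHead]
    exact (norm_mul_le _ _).trans
      (mul_le_mul (ha _ _) (norm_csChain_le_csHead T ha m _) (norm_nonneg _) (sq_nonneg _))

/-- Second grouping: `‖T_j^* T_{i₁}T_{j₁}^* ⋯ T_{i_m}T_{j_m}^*‖ ≤ M b(j,i₁)² b(j₁,i₂)² ⋯ b(j_{m-1},i_m)²`
if `‖T_i‖ ≤ M`. [cite: GrafakosMFA2014, §4.5.1, proof of Lemma 4.5.1] -/
theorem norm_star_mul_csChain_le (T : ι → E →L[ℂ] E) {b : ι → ι → ℝ} {M : ℝ}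
    (hb : ∀ i j, ‖star (T i) * T j‖ ≤ b i j ^ 2) (hM : ∀ i, ‖T i‖ ≤ M) :
    ∀ (m : ℕ) (j : ι) (g : Fin m → ι × ι), ‖star (T j) * csChain T m g‖ ≤ M * csTail b m j g
  | 0, j, _ => by
    simp only [csChain, csTail, mul_one]
    rw [ContinuousLinearMap.star_eq_adjoint, LinearIsometryEquiv.norm_map]
    exact hM j
  | m + 1, j, g => by
    simp only [csChain, csTail]
    have hassoc : star (T j) * (T (g 0).1 * star (T (g 0).2) * csChain T m (Fin.tail g)) =
        (star (T j) * T (g 0).1) * (star (T (g 0).2) * csChain T m (Fin.tail g)) := by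
      simp only [mul_assoc]
    rw [hassoc]
    have hM0 : 0 ≤ M := (norm_nonneg _).trans (hM j)
    calc ‖(star (T j) * T (g 0).1) * (star (T (g 0).2) * csChain T m (Fin.tail g))‖
        ≤ ‖star (T j) * T (g 0).1‖ * ‖star (T (g 0).2) * csChain T m (Fin.tail g)‖ :=
          norm_mul_le _ _
      _ ≤ b j (g 0).1 ^ 2 * (M * csTail b m (g 0).2 (Fin.tail g)) :=
          mul_le_mul (hb _ _) (norm_star_mul_csChain_le T hb hM m _ _) (norm_nonneg _)
            (sq_nonneg _)
      _ = M * (b j (g 0).1 ^ 2 * csTail b m (g 0).2 (Fin.tail g)) := by ring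

/-- Geometric mean of the two groupings for a chain of length `m + 1`:
`‖T_{i₁}T_{j₁}^*⋯‖ ≤ M a(i₁,j₁) b(j₁,i₂) a(i₂,j₂) ⋯ a(i_{m+1},j_{m+1})`. [cite: GrafakosMFA2014, §4.5.1, proof of Lemma 4.5.1] -/
theorem norm_csChain_succ_le (T : ι → E →L[ℂ] E) {a b : ι → ι → ℝ} {M : ℝ}
    (ha0 : ∀ i j, 0 ≤ a i j) (hb0 : ∀ i j, 0 ≤ b i j)
    (ha : ∀ i j, ‖T i * star (T j)‖ ≤ a i j ^ 2) (hb : ∀ i j, ‖star (T i) * T j‖ ≤ b i j ^ 2)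
    (hM : ∀ i, ‖T i‖ ≤ M) (m : ℕ) (f : Fin (m + 1) → ι × ι) :
    ‖csChain T (m + 1) f‖ ≤ M * a (f 0).1 (f 0).2 * csMean a b m (f 0).2 (Fin.tail f) := by
  have hM0 : 0 ≤ M := (norm_nonneg _).trans (hM (f 0).1)
  have hX : csChain T (m + 1) f = T (f 0).1 * star (T (f 0).2) * csChain T m (Fin.tail f) := rfl
  have hP : ‖csChain T (m + 1) f‖ ≤ a (f 0).1 (f 0).2 ^ 2 * csHead a m (Fin.tail f) := by
    rw [hX]
    exact (norm_mul_le _ _).trans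
      (mul_le_mul (ha _ _) (norm_csChain_le_csHead T ha m _) (norm_nonneg _) (sq_nonneg _))
  have hQ : ‖csChain T (m + 1) f‖ ≤ M * (M * csTail b m (f 0).2 (Fin.tail f)) := by
    rw [hX, mul_assoc]
    exact (norm_mul_le _ _).trans
      (mul_le_mul (hM _) (norm_star_mul_csChain_le T hb hM m _ _) (norm_nonneg _) hM0)
  have hnn : 0 ≤ M * a (f 0).1 (f 0).2 * csMean a b m (f 0).2 (Fin.tail f) :=
    mul_nonneg (mul_nonneg hM0 (ha0 _ _)) (csMean_nonneg ha0 hb0 m _ _)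
  have hmean : (M * a (f 0).1 (f 0).2 * csMean a b m (f 0).2 (Fin.tail f)) ^ 2 =
      (a (f 0).1 (f 0).2 ^ 2 * csHead a m (Fin.tail f)) *
        (M * (M * csTail b m (f 0).2 (Fin.tail f))) := by
    rw [mul_pow, mul_pow, csMean_sq]
    ring
  have h2 : ‖csChain T (m + 1) f‖ ^ 2 ≤
      (M * a (f 0).1 (f 0).2 * csMean a b m (f 0).2 (Fin.tail f)) ^ 2 := by
    rw [hmean, sq]
    exact mul_le_mul hP hQ (norm_nonneg _) ((norm_nonneg _).trans hP)
  exact le_of_pow_le_pow_left₀ two_ne_zero hnn h2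

/-- **The key estimate** `‖(S S^*)^{m+1}‖ ≤ |ι| · M · A · (A B)^m` (`S = ∑ T_i`, `‖T_i‖ ≤ M`).
[cite: GrafakosMFA2014, §4.5.1, proof of Lemma 4.5.1] -/
theorem norm_pow_succ_le [Fintype ι] (T : ι → E →L[ℂ] E) {a b : ι → ι → ℝ} {M A B : ℝ}
    (ha0 : ∀ i j, 0 ≤ a i j) (hb0 : ∀ i j, 0 ≤ b i j)
    (ha : ∀ i j, ‖T i * star (T j)‖ ≤ a i j ^ 2) (hb : ∀ i j, ‖star (T i) * T j‖ ≤ b i j ^ 2)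
    (hM : ∀ i, ‖T i‖ ≤ M) (hM0 : 0 ≤ M) (hA : ∀ i, ∑ j, a i j ≤ A) (hB : ∀ i, ∑ j, b i j ≤ B)
    (hA0 : 0 ≤ A) (hB0 : 0 ≤ B) (m : ℕ) :
    ‖((∑ i, T i) * star (∑ i, T i)) ^ (m + 1)‖ ≤ Fintype.card ι * M * A * (A * B) ^ m := by
  rw [pow_mul_star_sum_eq]
  refine (norm_sum_le _ _).trans ?_
  calc ∑ f : Fin (m + 1) → ι × ι, ‖csChain T (m + 1) f‖
      ≤ ∑ f : Fin (m + 1) → ι × ι, M * a (f 0).1 (f 0).2 * csMean a b m (f 0).2 (Fin.tail f) :=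
        Finset.sum_le_sum fun f _ => norm_csChain_succ_le T ha0 hb0 ha hb hM m f
    _ = ∑ q : ι × ι, ∑ g : Fin m → ι × ι, M * a q.1 q.2 * csMean a b m q.2 g := by
        rw [sum_fin_succ_eq]
        simp only [Fin.cons_zero, Fin.tail_cons]
    _ = ∑ q : ι × ι, M * a q.1 q.2 * ∑ g : Fin m → ι × ι, csMean a b m q.2 g := by
        simp_rw [Finset.mul_sum]
    _ ≤ ∑ q : ι × ι, M * a q.1 q.2 * (A * B) ^ m := by
        gcongr with q
        · exact mul_nonneg hM0 (ha0 _ _)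
        · exact sum_csMean_le ha0 hb0 hA hB hA0 hB0 m q.2
    _ = M * (∑ q : ι × ι, a q.1 q.2) * (A * B) ^ m := by
        rw [Finset.mul_sum, Finset.sum_mul]
    _ ≤ M * (Fintype.card ι * A) * (A * B) ^ m := by
        have hq : ∑ q : ι × ι, a q.1 q.2 ≤ Fintype.card ι * A :=
          calc ∑ q : ι × ι, a q.1 q.2 = ∑ i, ∑ j, a i j := Fintype.sum_prod_type _
            _ ≤ ∑ _i : ι, A := Finset.sum_le_sum fun i _ => hA i
            _ = Fintype.card ι * A := by
                rw [Finset.sum_const, Finset.card_univ, nsmul_eq_mul]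
        gcongr
    _ = Fintype.card ι * M * A * (A * B) ^ m := by ring

/-- **The Cotlar–Knapp–Stein lemma** (finite family, two-weight form). Let `T_i`, `i ∈ ι` finite,
be bounded operators on a complex Hilbert space, and `a, b ≥ 0` with `‖T_i T_j^*‖ ≤ a(i,j)²`,
`‖T_i^* T_j‖ ≤ b(i,j)²`, `∑_j a(i,j) ≤ A` and `∑_j b(i,j) ≤ B` for all `i`. Then
`‖∑_i T_i‖ ≤ √(A B)`. (With `a(i,j) = b(i,j) = √γ(i-j)`, `A = B = ∑ √γ`, this is the printed
"`‖∑_{j∈Λ} T_j‖ ≤ A`"; the bound does not depend on `|ι|`.) Proof: `‖S‖^{2^{k+1}} =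
‖(SS^*)^{2^k}‖ ≤ |ι| M A (AB)^{2^k - 1}` (`norm_pow_succ_le`, with `M = A ≥ ‖T_i‖` from
`‖T_i‖² = ‖T_iT_i^*‖ ≤ a(i,i)²`), then `k → ∞`. [cite: GrafakosMFA2014, §4.5.1, Lemma 4.5.1 (i)] -/
theorem cotlarStein_norm_sum_le [Fintype ι] (T : ι → E →L[ℂ] E) {a b : ι → ι → ℝ}
    (ha0 : ∀ i j, 0 ≤ a i j) (hb0 : ∀ i j, 0 ≤ b i j)
    (ha : ∀ i j, ‖T i * star (T j)‖ ≤ a i j ^ 2) (hb : ∀ i j, ‖star (T i) * T j‖ ≤ b i j ^ 2)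
    {A B : ℝ} (hA : ∀ i, ∑ j, a i j ≤ A) (hB : ∀ i, ∑ j, b i j ≤ B) :
    ‖∑ i, T i‖ ≤ Real.sqrt (A * B) := by
  rcases isEmpty_or_nonempty ι with hι | ⟨⟨i₀⟩⟩
  · simp
  have hA0 : 0 ≤ A := (Finset.sum_nonneg fun j _ => ha0 i₀ j).trans (hA i₀)
  have hB0 : 0 ≤ B := (Finset.sum_nonneg fun j _ => hb0 i₀ j).trans (hB i₀)
  -- `‖T_i‖ ≤ a(i,i) ≤ A`
  have hM : ∀ i, ‖T i‖ ≤ A := by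
    intro i
    have h1 : ‖T i‖ ^ 2 ≤ a i i ^ 2 := by
      rw [sq, ← CStarRing.norm_self_mul_star]
      exact ha i i
    have h2 : ‖T i‖ ≤ a i i := le_of_pow_le_pow_left₀ two_ne_zero (ha0 i i) h1
    exact h2.trans ((Finset.single_le_sum (fun j _ => ha0 i j) (Finset.mem_univ i)).trans (hA i))
  set S : E →L[ℂ] E := ∑ i, T i with hS
  have hsa : IsSelfAdjoint (S * star S) := IsSelfAdjoint.mul_star_self S
  have hS2 : ‖S‖ ^ 2 = ‖S * star S‖ := by
    rw [sq]
    exact CStarRing.norm_self_mul_star.symm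
  -- the estimate along powers of two
  have hpow : ∀ k : ℕ, (‖S‖ ^ 2) ^ (2 ^ k) ≤ Fintype.card ι * A * A * (A * B) ^ (2 ^ k - 1) := by
    intro k
    rw [hS2, ← hsa.norm_pow_two_pow]
    have hk : 2 ^ k = (2 ^ k - 1) + 1 := (Nat.sub_add_cancel Nat.one_le_two_pow).symm
    rw [hk, Nat.add_sub_cancel]
    exact norm_pow_succ_le T ha0 hb0 ha hb hM hA0 hA hB hA0 hB0 (2 ^ k - 1)
  -- conclude by letting `k → ∞`
  by_contra hlt
  rw [not_le] at hlt
  have hSpos : 0 < ‖S‖ := (Real.sqrt_nonneg _).trans_lt hlt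
  have hlt2 : A * B < ‖S‖ ^ 2 := (Real.sqrt_lt' hSpos).1 hlt
  set c : ℝ := Fintype.card ι * A * A with hc
  rcases (mul_nonneg hA0 hB0).eq_or_lt with hAB | hAB
  · -- `A B = 0`: take `k = 1`
    have h := hpow 1
    have h0 : (A * B) ^ (2 ^ 1 - 1) = 0 := by rw [← hAB]; norm_num
    rw [h0, mul_zero] at h
    have hS0 : ‖S‖ ^ 2 = 0 := by
      have h' : (‖S‖ ^ 2) ^ 2 ^ 1 = 0 := le_antisymm h (by positivity)
      exact (pow_eq_zero_iff (by norm_num)).1 h'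
    rw [hS0] at hlt2
    exact (not_lt.2 (mul_nonneg hA0 hB0)) hlt2
  · -- `A B > 0`: `(‖S‖²/(AB))^{2^k} ≤ c/(AB)` for all `k`, impossible as the ratio exceeds `1`
    set r : ℝ := ‖S‖ ^ 2 / (A * B) with hr
    have hr1 : 1 < r := by rw [hr, one_lt_div hAB]; exact hlt2
    have hbound : ∀ k : ℕ, r ^ (2 ^ k) ≤ c / (A * B) := by
      intro k
      rw [hr, div_pow, div_le_div_iff₀ (pow_pos hAB _) hAB]
      have h := hpow k
      have hk : (A * B) ^ (2 ^ k) = (A * B) ^ (2 ^ k - 1) * (A * B) := by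
        rw [← pow_succ, Nat.sub_add_cancel Nat.one_le_two_pow]
      calc (‖S‖ ^ 2) ^ 2 ^ k * (A * B) ≤ c * (A * B) ^ (2 ^ k - 1) * (A * B) :=
            mul_le_mul_of_nonneg_right h hAB.le
        _ = c * (A * B) ^ 2 ^ k := by rw [hk]; ring
    obtain ⟨n, hn⟩ := Filter.eventually_atTop.1
      ((tendsto_pow_atTop_atTop_of_one_lt hr1).eventually_gt_atTop (c / (A * B)))
    have h1 := hn (2 ^ n) (Nat.lt_two_pow_self).le
    exact (not_lt.2 (hbound n)) h1

end Chains

end Literature.Analysis.OperatorTheory
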